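import Summits.Ventures.HodgeKum4.Statement
import Literature.AlgebraicGeometry.Hyperkaehler.GeneralizedKummerTypeTranslationGroup
import Literature.AlgebraicGeometry.Hyperkaehler.GeneralizedKummerTypeFixedFourfold
import Literature.AlgebraicGeometry.Hyperkaehler.LooijengaLuntsVerbitsky
import Literature.AlgebraicGeometry.HodgeTheory.ComplexOrientationFamily
import Literature.AlgebraicTopology.SingularHomology.HomologyRingChange
import Literature.AlgebraicTopology.SingularHomology.CohomologyRingChange
import Mathlib.LinearAlgebra.QuadraticForm.Signature
import Mathlib.CategoryTheory.Limits.Shapes.Pullback.IsPullback.Defs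
import Literature.AlgebraicGeometry.GroupActions.FixedPointScheme
import HarnessLib

/-!
# Definitions for route `KummerFixedLocus` (cell `hodge-kum4`, seat p2)

The vocabulary of seat p2's kernel files for crux I / L3° (`Kum4FixedFourfoldClasses`,
`Kum4NonInvariantClassesAlgebraic`), collected in one reviewed module (no definition is buried in a
proof file):

* real carriers: `realBetti`, `realBetti.map`, `realFundamentalClass X μ = [X(ℂ)]_μ ⊗ 1`,
  `realPairing X μ = ⟨· ∪ ·, [X]_ℝ⟩` on `H⁸(X(ℂ); ℝ)`, `middleRepReal` (`Γ(X)` on `H⁸(X(ℂ); ℝ)`,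
  `g ↦ (g⁻¹)^*`), `sig` (`σ₊ − σ₋` of a real bilinear form), `complexify` (`c ↦ c ⊗ 1`);
* complex pairing: `complexFundamentalClass`, `complexPairingWith X μ w = ⟨w ∪ ·, [X]_ℂ⟩`;
* LLV bookkeeping: `totalRep` (total action of `Γ(X)` on `H*`), `coinvariantsKerTotal` (`𝒦_tot`),
  `annihilatorLieSubalgebra`, `parityOp` (`(−1)^k` on `Hᵏ`); `totalDominated` (classes of `H*` all of
  whose components are dominated by the powers of `B`, `Statement` §6 — the carrier of L2a′);
* the SINGLE non-print input of crux I, as ONE `@[conjecture]`-tagged proposition on the Kummer fixed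
  datum `Hyperkaehler.IsKummerFixedDatum X ι W i` (the body of the printed fact A2 without its leading
  existential, Literature): the geometric residual I1geo `Kum4FixedFourfoldMeetsTranslates` (`W ×_X gW`
  is one reduced point; ELEMENTARY, UNPUBLISHED, cell-proved on paper, OPEN in the kernel — planner
  decision / referee co-signature REF-AUDIT-10 / director D-0071: one residual vocabulary).  Its numerical
  form I1R ("`⟨w ∪ ρ(g)w, [X]⟩ = ε' = ±1`") is NOT a definition: it is the conclusion of the PROVED theorem
  `kum4FixedFourfoldTranslatesR_of_meetsTranslates` (file `KummerFixedLocusTranslatesOfTransversal`,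
  from I1geo and the printed intersection-number fact `HodgeTheory.Fulton1998_cupPairing_transversalPoint`).
  (A5, "the Kummer involution fixes `H⁸(X(ℂ); ℂ)^Γ`", is PROVED from André's guarded dual-Lefschetz fact +
  L1 in `KummerFixedLocusInvolutionParity` and needs no name.)
-/

noncomputable section

open DirectSum CategoryTheory MonoidalCategory Representation QuadraticMap QuadraticForm
open Literature.AlgebraicTopology.SingularHomology
open Literature.AlgebraicGeometry Literature.AlgebraicGeometry.HodgeTheory
open Literature.AlgebraicGeometry.Hyperkaehler (IsOfGeneralizedKummerType translationRep totalCohomology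
  ofDegree)

attribute [local instance 100] LieRing.ofAssociativeRing

namespace Summit.Ventures.HodgeKum4

/-! ### Real carriers -/

/-- `Hᵏ(X(ℂ); ℝ)`: real singular cohomology of the complex points. -/
abbrev realBetti (X : Motives.SchemeOver ℂ) (k : ℕ) : ModuleCat ℝ :=
  singularCohomology ℝ ℝ (Motives.ComplexPoints X) k

/-- Pull-back `f^* : Hᵏ(Y(ℂ); ℝ) ⟶ Hᵏ(X(ℂ); ℝ)` along a `ℂ`-morphism. -/
abbrev realBetti.map {X Y : Motives.SchemeOver ℂ} (f : X ⟶ Y) (k : ℕ) :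
    realBetti Y k ⟶ realBetti X k :=
  singularCohomology.map ℝ ℝ (Motives.AlgPoints.mapContinuous (L := ℂ) f) k

/-- `(𝟙 X)^* = 𝟙`. -/
@[simp]
theorem realBetti.map_id {X : Motives.SchemeOver ℂ} (k : ℕ) : realBetti.map (𝟙 X) k = 𝟙 _ := by
  rw [realBetti.map, Motives.AlgPoints.mapContinuous_id, singularCohomology.map_id]

/-- `(f ≫ g)^* = g^* ≫ f^*`. -/
theorem realBetti.map_comp {X Y Z : Motives.SchemeOver ℂ} (f : X ⟶ Y) (g : Y ⟶ Z) (k : ℕ) :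
    realBetti.map (f ≫ g) k = realBetti.map g k ≫ realBetti.map f k := by
  rw [realBetti.map, Motives.AlgPoints.mapContinuous_comp, singularCohomology.map_comp]

/-- The real fundamental class `[X(ℂ)] ⊗ 1 ∈ H₁₆(X(ℂ); ℝ)` of a `ℤ`-orientation `μ` (for `Kum⁴`:
real dimension `16`). -/
def realFundamentalClass (X : Motives.SchemeOver ℂ)
    (μ : HomologicalOrientation ℤ (Motives.ComplexPoints X) 16) :
    singularHomology ℝ ℝ (Motives.ComplexPoints X) 16 :=
  singularHomology.coeffChange (Motives.ComplexPoints X) (algebraMap ℤ ℝ : ℤ →+* ℝ).toAddMonoidHom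
    16 μ.fundamentalClass

/-- The real cup pairing on `H⁸(X(ℂ); ℝ)`: `(y, y') ↦ ⟨y ∪ y', [X(ℂ)] ⊗ 1⟩`. -/
def realPairing (X : Motives.SchemeOver ℂ)
    (μ : HomologicalOrientation ℤ (Motives.ComplexPoints X) 16) :
    LinearMap.BilinForm ℝ (realBetti X 8) :=
  (cupProduct (R := ℝ) (X := Motives.ComplexPoints X) (rfl : 8 + 8 = 16)).compr₂
    ((kroneckerPairing ℝ ℝ (Motives.ComplexPoints X) 16).flip (realFundamentalClass X μ))

/-- Unfolding. -/
theorem realPairing_apply (X : Motives.SchemeOver ℂ)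
    (μ : HomologicalOrientation ℤ (Motives.ComplexPoints X) 16) (y y' : realBetti X 8) :
    realPairing X μ y y' =
      kroneckerPairing ℝ ℝ (Motives.ComplexPoints X) 16 (cupProduct (rfl : 8 + 8 = 16) y y')
        (realFundamentalClass X μ) :=
  rfl

/-- The representation of `Γ(X)` on `H⁸(X(ℂ); ℝ)`, `g ↦ (g⁻¹)^*`. -/
def middleRepReal (X : Motives.SchemeOver ℂ) :
    Representation ℝ (autFixingH2H3 X) (realBetti X 8) where
  toFun g := (realBetti.map (g⁻¹ : autFixingH2H3 X).val.hom 8).hom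
  map_one' := by
    rw [inv_one]
    change (realBetti.map (𝟙 X) 8).hom = _
    rw [realBetti.map_id]
    rfl
  map_mul' g h := by
    rw [mul_inv_rev]
    change (realBetti.map ((g⁻¹).val.hom ≫ (h⁻¹).val.hom) 8).hom = _
    rw [realBetti.map_comp]
    rfl

/-- `ρ(g) = (g⁻¹)^*`. -/
theorem middleRepReal_apply {X : Motives.SchemeOver ℂ} (g : autFixingH2H3 X) (c : realBetti X 8) :
    middleRepReal X g c = (realBetti.map (g⁻¹ : autFixingH2H3 X).val.hom 8).hom c :=
  rfl

/-- The signature `σ₊ − σ₋` of (the quadratic form of) a real bilinear form. -/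
def sig {V : Type*} [AddCommGroup V] [Module ℝ V] (B : LinearMap.BilinForm ℝ V) : ℤ :=
  (sigPos (LinearMap.BilinMap.toQuadraticMap B) : ℤ) - sigNeg (LinearMap.BilinMap.toQuadraticMap B)


/-! ### Complexification and the complex pairing -/

/-- Complexification `c ↦ c ⊗ 1 : Hᵏ(X(ℂ); ℝ) → Hᵏ(X(ℂ); ℂ)`. -/
abbrev complexify (X : Motives.SchemeOver ℂ) (k : ℕ) :
    singularCohomology ℝ ℝ (Motives.ComplexPoints X) k →+ complexBetti X k :=
  singularCohomology.ringChange (algebraMap ℝ ℂ) (Motives.ComplexPoints X) k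


/-- The complex fundamental class `[X(ℂ)] ⊗ 1 ∈ H₁₆(X(ℂ); ℂ)` of a `ℤ`-orientation. -/
def complexFundamentalClass (X : Motives.SchemeOver ℂ)
    (μ : HomologicalOrientation ℤ (Motives.ComplexPoints X) 16) :
    singularHomology ℂ ℂ (Motives.ComplexPoints X) 16 :=
  singularHomology.coeffChange (Motives.ComplexPoints X) (algebraMap ℤ ℂ : ℤ →+* ℂ).toAddMonoidHom
    16 μ.fundamentalClass

/-- The functional `φ_w = ⟨w ∪ ·, [X(ℂ)] ⊗ 1⟩` on `H⁸(X(ℂ); ℂ)` (Poincaré pairing with `w`). -/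
def complexPairingWith (X : Motives.SchemeOver ℂ)
    (μ : HomologicalOrientation ℤ (Motives.ComplexPoints X) 16) (w : complexBetti X 8) :
    complexBetti X 8 →ₗ[ℂ] ℂ :=
  (kroneckerPairing ℂ ℂ (Motives.ComplexPoints X) 16).flip (complexFundamentalClass X μ) ∘ₗ
    cupProduct (R := ℂ) (X := Motives.ComplexPoints X) (rfl : 8 + 8 = 16) w

/-- Unfolding: `φ_w y = ⟨w ∪ y, [X(ℂ)] ⊗ 1⟩`. -/
theorem complexPairingWith_apply (X : Motives.SchemeOver ℂ)
    (μ : HomologicalOrientation ℤ (Motives.ComplexPoints X) 16) (w y : complexBetti X 8) :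
    complexPairingWith X μ w y =
      kroneckerPairing ℂ ℂ (Motives.ComplexPoints X) 16 (cupProduct (rfl : 8 + 8 = 16) w y)
        (complexFundamentalClass X μ) :=
  rfl


/-! ### LLV bookkeeping on the total cohomology -/

section Total

variable {X : Motives.SchemeOver ℂ}

/-- The **total action** `T_g = ⨁ₖ ρₖ(g)` of `g ∈ Γ(X)` on `H*(X(ℂ); ℂ) = ⨁ₖ Hᵏ`. -/
def totalRep (g : Hyperkaehler.autFixingH2H3 X) :
    Module.End ℂ (totalCohomology ℂ (Motives.ComplexPoints X)) :=
  toModule ℂ ℕ (totalCohomology ℂ (Motives.ComplexPoints X)) fun k ↦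
    ofDegree ℂ (Motives.ComplexPoints X) k ∘ₗ translationRep X k g


variable (X) in
/-- `𝒦_tot ⊂ H*(X(ℂ); ℂ)`: the image of `𝒦 ⊂ H⁸` in total cohomology. -/
def coinvariantsKerTotal : Submodule ℂ (totalCohomology ℂ (Motives.ComplexPoints X)) :=
  (Representation.Coinvariants.ker (translationRep X 8)).map (ofDegree ℂ (Motives.ComplexPoints X) 8)


end Total

/-- The annihilator of a submodule `S ⊆ M` in `gl(M)`: a Lie subalgebra (if `E, F` kill `S` then so
does `⁅E, F⁆ = EF - FE`). -/
def annihilatorLieSubalgebra {M : Type*} [AddCommGroup M] [Module ℂ M] (S : Submodule ℂ M) :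
    LieSubalgebra ℂ (Module.End ℂ M) where
  carrier := {E | ∀ w ∈ S, E w = 0}
  zero_mem' := fun _ _ ↦ rfl
  add_mem' {E F} hE hF := fun w hw ↦ by rw [LinearMap.add_apply, hE w hw, hF w hw, add_zero]
  smul_mem' c {E} hE := fun w hw ↦ by rw [LinearMap.smul_apply, hE w hw, smul_zero]
  lie_mem' {E F} hE hF := fun w hw ↦ by
    rw [Ring.lie_def, LinearMap.sub_apply, Module.End.mul_apply, Module.End.mul_apply, hF w hw,
      hE w hw, map_zero, map_zero, sub_zero]

/-- Membership in the annihilator. -/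
theorem mem_annihilatorLieSubalgebra_iff {M : Type*} [AddCommGroup M] [Module ℂ M]
    (S : Submodule ℂ M) (E : Module.End ℂ M) :
    E ∈ annihilatorLieSubalgebra S ↔ ∀ w ∈ S, E w = 0 :=
  Iff.rfl


section Parity

universe u

variable {Y : Type u} [TopologicalSpace Y]

variable (Y) in
/-- The **parity operator** `P = (−1)^k` on `Hᵏ(Y; ℂ)`, assembled on `H*(Y; ℂ)`. -/
def parityOp : Module.End ℂ (totalCohomology ℂ Y) :=
  toModule ℂ ℕ (totalCohomology ℂ Y) fun k ↦ ((-1 : ℂ) ^ k) • ofDegree ℂ Y k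


end Parity


/-! ### Total dominated classes (bookkeeping carrier for the span-form node L2a′) -/

/-- **The total dominated classes** of `Y` with respect to the powers of `B`: the classes in
`H*(Y(ℂ); ℂ) = ⨁ₖ Hᵏ` all of whose homogeneous components lie in `dominatedClasses dY Y dX B k`
(`Statement` §6: the `ℂ`-span of the images of algebraic correspondences from the powers `Bᵉ`).
The carrier on which "`opCupSpan Λ (degreeClasses {0,2,3}) ⊆` dominated" (L1 ⟹ L2a′) is proved. -/
def totalDominated (dY : ℕ) (Y : Motives.SchemeOver ℂ) (dX : ℕ) (B : Motives.SchemeOver ℂ) :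
    Submodule ℂ (totalCohomology ℂ (Motives.ComplexPoints Y)) where
  carrier := {v | ∀ k, v k ∈ dominatedClasses dY Y dX B k}
  zero_mem' := fun k => by simp
  add_mem' := fun {v w} hv hw k => by
    rw [DirectSum.add_apply]; exact Submodule.add_mem _ (hv k) (hw k)
  smul_mem' := fun c {v} hv k => by
    rw [DirectSum.smul_apply]; exact Submodule.smul_mem _ c (hv k)

/-- Membership in `totalDominated` (unfolding). -/
theorem mem_totalDominated_iff {dY : ℕ} {Y : Motives.SchemeOver ℂ} {dX : ℕ} {B : Motives.SchemeOver ℂ}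
    (v : totalCohomology ℂ (Motives.ComplexPoints Y)) :
    v ∈ totalDominated dY Y dX B ↔ ∀ k, v k ∈ dominatedClasses dY Y dX B k :=
  Iff.rfl

/-- A homogeneous class is totally dominated iff it is dominated in its degree. -/
theorem ofDegree_mem_totalDominated_iff {dY : ℕ} {Y : Motives.SchemeOver ℂ} {dX : ℕ}
    {B : Motives.SchemeOver ℂ} {k : ℕ} (c : complexBetti Y k) :
    ofDegree ℂ (Motives.ComplexPoints Y) k c ∈ totalDominated dY Y dX B ↔
      c ∈ dominatedClasses dY Y dX B k := by
  classical
  rw [mem_totalDominated_iff]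
  constructor
  · intro h
    simpa [ofDegree, DirectSum.lof_eq_of, DirectSum.of_eq_same] using h k
  · intro h j
    by_cases hjk : j = k
    · subst hjk; simpa [ofDegree, DirectSum.lof_eq_of, DirectSum.of_eq_same] using h
    · have h0 : (ofDegree ℂ (Motives.ComplexPoints Y) k c) j = 0 := by
        rw [ofDegree, DirectSum.lof_eq_of]
        exact DirectSum.of_eq_of_ne (β := fun i => singularCohomology ℂ ℂ (Motives.ComplexPoints Y) i)
          k j c hjk
      rw [h0]
      exact Submodule.zero_mem _

/-! ### The non-print input of crux I: the geometric residual I1geo (open obligation) -/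

/-- **I1geo — the fixed fourfold meets each of its `Γ`-translates in ONE REDUCED POINT** (THE
residual of the route: the BOOKED residual child of the L3° split — planner decision on HOME/p2/I1GEO.md,
referee co-signature REF-AUDIT-10 §1, director D-0071; its numerical form I1R is the conclusion of the
proved theorem `kum4FixedFourfoldTranslatesR_of_meetsTranslates`).  For `X` smooth projective
of `Kum⁴`-type, a Kummer fixed datum `(ι, W, i)` and `g ∈ Γ(X) ∖ 1`, the scheme-theoretic intersection
of `i : W ⟶ X` with the translate `i ≫ g : W ⟶ X` is `Spec ℂ`: there are points `p, q : 𝟙_ ⟶ W` with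
`IsPullback p q i (i ≫ g)` — i.e. `W ∩ gW` is a single point at which the two smooth fourfolds meet
transversally (Fulton, *Intersection Theory* Prop. 8.2 (b)–(c), Remark 8.2: length one ⟺
non-singular and transversal).  At the Kummer point `K⁴(A)`: `W₀ ∩ t_z W₀ = {⟨z⟩-orbit of 0}`, one
reduced point, since `W₀ ∩ t_z W₀ ⊆ Fix(−1) ∩ Fix(t_u)`, `Fix(t_u)` is `125` reduced cosets and only
the coset `⟨u⟩` is symmetric; transversal because a vector tangent to both fixed fourfolds is fixed
by the translation, whose fixed points are isolated (Cartan) — paper proof HOME/p2/I1-PROOF.md,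
referee'd in the cell.  Transport to an arbitrary `X` of `Kum⁴`-type (paper proof in the cell's
HOME/p2/I1GEO-TRANSPORT.md): `W ∩ gW ⊆ Fix⟨ι, g⟩` (from `ι x = x = ι g⁻² x` one gets `g² x = x`, so
`g x = x`) and `⟨ι, g⟩ ≅ D₅`; along a `Γ ⋊ ⟨ι⟩`-equivariant deformation to a Kummer point
(Hassett–Tschinkel 2013 Thm. 2.1) the fixed scheme of `D₅` is smooth over the base with tangent
spaces `(T_x X_b)^{D₅}`
(Cartan–Iversen linearisation), hence finite étale of degree one since it is one reduced point over
the Kummer point: on every fibre `W_b ∩ g W_b` is one point, on the fourfold component by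
connectedness, with `T W_b ∩ T gW_b = (T X_b)^{D₅} = 0` — the "properness step" (`W ∩ gW` stays
`0`-dimensional) is discharged by smoothness of fixed schemes, and what is not in print is the
Kummer-point computation for `n = 4`.  ELEMENTARY, UNPUBLISHED.  Tagged `@[conjecture]`.
With the printed intersection-number fact `HodgeTheory.Fulton1998_cupPairing_transversalPoint` it
gives the intersection numbers `⟨w ∪ ρ(g)w, [X]⟩ = ε' = ±1`, uniformly in `g ≠ 1`
(`kum4FixedFourfoldTranslatesR_of_meetsTranslates`, file `KummerFixedLocusTranslatesOfTransversal`),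
hence crux I and L3°. -/
@[conjecture] def Kum4FixedFourfoldMeetsTranslates : Prop :=
  ∀ ⦃X : Motives.SchemeOver ℂ⦄, Motives.IsSmoothProjective 8 X → IsOfGeneralizedKummerType 4 X →
    ∀ (ι : Aut X) ⦃W : Motives.SchemeOver ℂ⦄ (i : W ⟶ X), Hyperkaehler.IsKummerFixedDatum X ι W i →
      ∀ g : autFixingH2H3 X, g ≠ 1 →
        ∃ (p q : 𝟙_ (Motives.SchemeOver ℂ) ⟶ W), IsPullback p q i (i ≫ g.val.hom)


/-! ### The restricted residuals at the generalized Kummer varieties `K⁴(A)` (booking B′/B″,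
director-hodge 2026-08-26T05:44:16Z / 06:35:07Z; seat p2 memos HOME/p2/I1GEO-SPLIT-OPTION.md,
I1GEO-ATOMS-r2.md) -/

/-- **I1geo AT THE KUMMER VARIETIES** — `Kum4FixedFourfoldMeetsTranslates` VERBATIM with `X`
specialised to the generalized Kummer varieties themselves: for every abelian surface `A`
(`A.dim = 2`), every `K` with `Hyperkaehler.IsGeneralizedKummerVarietyOf 4 A K` (the
Albanese-difference fibre of `A^[5]`, Beauville) which is smooth projective of dimension `8`, every
Kummer fixed datum `(ι₀, W₀, i₀)` on `K` and every `g ∈ Γ(K) ∖ 1`, the scheme-theoretic intersection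
`W₀ ×_K g(W₀)` is `Spec ℂ`.  Implied by I1geo (`kum4FixedFourfoldMeetsTranslates_atKummerPoints_of`,
module `KummerFixedLocusKummerPointTransport`); together with the printed cohomological transport
fact `Hyperkaehler.HassettTschinkel2013_Floccari2026_fixedFourfoldClass_transport_kum4Type`, the
route's other printed facts and L1 it gives crux I, L3° and `HC_Kum4Type`
(`kum4NonInvariantClassesAlgebraic_of_L1_of_kummerPoint`, `hc_kum4Type_of_L1_of_kummerPoint`).  A
statement about EXPLICIT algebraic varieties; OPEN in the kernel (needs the Hilbert-scheme point
model of `K⁴(A)`); implied by the point count `Kum4FixedPointCountAtKummer` below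
(`kum4FixedFourfoldMeetsTranslates_atKummerPoints_of_split_of_count`, module
`KummerFixedLocusKummerPointAssembly`).  Tagged `@[conjecture]`. -/
@[conjecture] def Kum4FixedFourfoldMeetsTranslatesAtKummer : Prop :=
  ∀ ⦃A : Motives.AbelianVariety ℂ⦄ ⦃K : Motives.SchemeOver ℂ⦄, A.dim = 2 →
    Hyperkaehler.IsGeneralizedKummerVarietyOf 4 A K → Motives.IsSmoothProjective 8 K →
    ∀ (ι₀ : Aut K) ⦃W₀ : Motives.SchemeOver ℂ⦄ (i₀ : W₀ ⟶ K), Hyperkaehler.IsKummerFixedDatum K ι₀ W₀ i₀ →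
      ∀ g : autFixingH2H3 K, g ≠ 1 →
        ∃ (p q : 𝟙_ (Motives.SchemeOver ℂ) ⟶ W₀), IsPullback p q i₀ (i₀ ≫ g.val.hom)

/-- **THE POINT COUNT AT THE KUMMER VARIETIES — the residual of the fixed-locus branch under
booking B″** (director-hodge 2026-08-26T06:35:07Z: "the only unproved non-print input of the Kum⁴
rung is now a count of points on classical generalized Kummer varieties").  For every abelian
surface `A`, every smooth projective `K` with `IsGeneralizedKummerVarietyOf 4 A K`, every Kummer
fixed datum `(ι₀, W₀, i₀)` on `K`, every `g ∈ Γ(K) ∖ 1`, every fixed-point scheme `j : F ⟶ K` of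
`⟨g⟩` (`GroupActions.IsFixedPointScheme (Subgroup.zpowers g).subtype j`, Conrad–Gabber–Prasad
A.8.10(1)) and every splitting of `F` into `125` sections `x k : Spec ℂ ⟶ F`
(`IsColimit (Cofan.mk F x)` — the printed shape of the fixed points of `A[5]` on `K⁴(A)`, Oguiso
2020 Prop. 3.6: `Hyperkaehler.Oguiso2020_fixedPointScheme_translation_generalizedKummerFour`):
EXACTLY ONE of the points `x k ≫ j` lies on `W₀` (lifts along `i₀`).  Paper proof (cell,
HOME/p2/I1-PROOF.md Steps 1–2, I1GEO-ATOMS-r2 §Addendum): the `125` fixed points of `t_u` are the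
cosets `a + ⟨u⟩`, `a ∈ A[5]/⟨u⟩`; those on `W₀ ⊆ Fix(ι₀)` are the `(−1)`-symmetric ones, i.e. `⟨u⟩`
alone (`2 ∈ (ℤ/5)ˣ`), and `⟨u⟩ = {0, ±u, ±2u} ∈ W₀` (Floccari Def. 4.1).  ELEMENTARY, UNPUBLISHED;
a statement about finitely many `ℂ`-points of explicit varieties; its kernel proof needs ONLY the
Hilbert-scheme point model of `K⁴(A)` (cell item D3) — no tangent spaces, no families.  With
Oguiso's split shape and `|Γ| = 625` it gives `Kum4FixedFourfoldMeetsTranslatesAtKummer`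
(`kum4FixedFourfoldMeetsTranslates_atKummerPoints_of_split_of_count`), hence, with the printed
facts, (T) and L1, `HC_Kum4Type` (`hc_kum4Type_of_L1_of_count`).  Tagged `@[conjecture]`. -/
@[conjecture] def Kum4FixedPointCountAtKummer : Prop :=
  ∀ ⦃A : Motives.AbelianVariety ℂ⦄ ⦃K : Motives.SchemeOver ℂ⦄, A.dim = 2 →
    Hyperkaehler.IsGeneralizedKummerVarietyOf 4 A K → Motives.IsSmoothProjective 8 K →
    ∀ (ι₀ : Aut K) ⦃W₀ : Motives.SchemeOver ℂ⦄ (i₀ : W₀ ⟶ K), Hyperkaehler.IsKummerFixedDatum K ι₀ W₀ i₀ →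
      ∀ g : autFixingH2H3 K, g ≠ 1 → ∀ ⦃F : Motives.SchemeOver ℂ⦄ (j : F ⟶ K),
        GroupActions.IsFixedPointScheme (Subgroup.zpowers g.val).subtype j →
        ∀ (x : Fin 125 → (𝟙_ (Motives.SchemeOver ℂ) ⟶ F)),
          Nonempty (Limits.IsColimit (Limits.Cofan.mk F x)) →
          ∃ k₀ : Fin 125, (∃ p : 𝟙_ (Motives.SchemeOver ℂ) ⟶ W₀, p ≫ i₀ = x k₀ ≫ j) ∧
            ∀ k, k ≠ k₀ → ∀ p : 𝟙_ (Motives.SchemeOver ℂ) ⟶ W₀, p ≫ i₀ ≠ x k ≫ j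


/-- **THE ATOM OF THE POINT COUNT (torsor road; seat p1, cell memo HOME/p1/count/COUNT-SHAPE.md,
seat p2 HOME/p2/D3-INTERFACE.md r2 item J5; director-hodge 2026-08-26T07:34:45Z / 07:45:26Z): on a
generalized Kummer variety `K⁴(A)`, the fixed fourfold of every Kummer fixed datum contains a fixed point
of every non-trivial element of `Γ(K)`.**  For every abelian surface `A`, every smooth projective `K`
with `IsGeneralizedKummerVarietyOf 4 A K`, every Kummer fixed datum `(ι₀, W₀, i₀)` on `K` and every
`g ∈ Γ(K) ∖ 1` there is a `ℂ`-point `p` of `W₀` whose image `i₀(p)` is fixed by `g`.  Paper proof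
(cell): `Γ(K) = A[5]` acting by translations and `ι₀ = t_a ∘ (−1)` (Boissière–Nieper-Wißkirchen–Sarti
Cor. 3.3(2), Oguiso 2020 Lem. 3.4); for `g = t_u` and `b` with `2b = a` the REDUCED configuration
`{b, b ± u, b ± 2u}` (five distinct points, `u` of order `5`, with the fibre's sum) is `t_u`-fixed and
`ι₀`-symmetric with exactly one `ι₀`-fixed element, hence of the generic type of Floccari's fixed
fourfold (GT 2026 Def. 4.1 / Lem. 4.2: the closure of the configurations `{c, c ± x, c ± y}`), which
is the unique `4`-dimensional component of `Fix(ι₀)` = `i₀(W₀)` by the datum's dimension clause.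
ELEMENTARY, UNPUBLISHED — «existence of one fixed point on the fixed fourfold»; its kernel proof needs
the point model M1–M4 of D3-INTERFACE r2 (one explicit `ℂ`-point of `K` via
`IsHilbertSchemeOfPoints.lift`, the translations and `−1` on it, and the printed identifications).
TOGETHER WITH the printed transitivity of `Γ(K)` on the `g`-fixed points
(`Hyperkaehler.Oguiso2020_translations_transitive_fixedPoints_generalizedKummerFour`, Oguiso Prop. 3.6
proof), `Γ(K) ≅ (ℤ/5)⁴` (`FloccariVaresco2024_autFixingH2H3_equiv_kumType`) and the kernel odd-torsor
lemma (`Theorems/KummerFixedLocusOddTorsor`: the UNIQUENESS half of the count is group theory) it gives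
the point count `Kum4FixedPointCountAtKummer` (item stmt-Ventures-19504).  Tagged `@[conjecture]`. -/
@[conjecture] def Kum4FixedFourfoldHasFixedPointAtKummer : Prop :=
  ∀ ⦃A : Motives.AbelianVariety ℂ⦄ ⦃K : Motives.SchemeOver ℂ⦄, A.dim = 2 →
    Hyperkaehler.IsGeneralizedKummerVarietyOf 4 A K → Motives.IsSmoothProjective 8 K →
    ∀ (ι₀ : Aut K) ⦃W₀ : Motives.SchemeOver ℂ⦄ (i₀ : W₀ ⟶ K), Hyperkaehler.IsKummerFixedDatum K ι₀ W₀ i₀ →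
      ∀ g : autFixingH2H3 K, g ≠ 1 →
        ∃ p : 𝟙_ (Motives.SchemeOver ℂ) ⟶ W₀, (p ≫ i₀) ≫ g.val.hom = p ≫ i₀


end Summit.Ventures.HodgeKum4

end
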